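import Literature.Analysis.PDE.QuasilinearIteration
import Literature.Analysis.PDE.QuasilinearLimit
import Literature.Analysis.PDE.JetTower
import HarnessLib

/-!
# The frozen Picard scheme for quasilinear parabolic systems: convergence (topic `Analysis/PDE`)

Layer (III), step 5c (convergence), of the programme to prove short-time existence for
quasilinear strictly parabolic systems on a closed manifold (hypothesis `hQL` of
`Literature.Geometry.Riemannian.ricciFlow_shortTime_existence_of_quasilinear`). From the geometric
decay of the differences of the Picard iterates at every order (`QuasilinearIteration.lean`) we
obtain, chart by chart, limits of the cut-off chart expressions `ŵ_q(v_k)` and of the extended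
chart expressions of the sources `Θ(v_k)`, with uniform convergence of all frame-word
derivatives on the slab.

* `words_cauchy_of_geometric` — frame words of a slab family with geometrically decaying energies
  of consecutive differences are uniformly Cauchy;
* `PicardData.exists_word_limits` — the chart limits of the Picard scheme.

Everything is proved; no named fact and no `sorry` is introduced.

## References

* M. E. Taylor, *Partial Differential Equations III*, 2nd ed., Springer 2011, Ch. 15, §7.
  [TaylorPDEIII2011]
-/

noncomputable section

open Set Function Filter Topology Metric MeasureTheory InnerProductSpace
open scoped Manifold ContDiff Topology ENNReal RealInnerProductSpace

namespace Literature.Analysis.PDE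

open Literature.Geometry.Manifold Literature.Analysis.FunctionSpaces Literature.Analysis.FluidPDE

variable {E' : Type*} [NormedAddCommGroup E'] [InnerProductSpace ℝ E'] [FiniteDimensional ℝ E']
  [MeasurableSpace E'] [BorelSpace E']
variable {W' : Type*} [NormedAddCommGroup W'] [InnerProductSpace ℝ W'] [FiniteDimensional ℝ W']

/-! ### Uniform Cauchy property of frame words from geometric decay of energies -/

/-- **Frame words are uniformly Cauchy when the energies of consecutive differences decay
geometrically.** For a family `g N t` of smooth compactly supported functions on the slab with
`E_K(g_{N+1}(t) - g_N(t)) ≤ C_K 2^{-N}` for every `K`, every frame-word derivative is uniformly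
Cauchy on the slab, uniformly over words of bounded length. [cite: Evans2010, §5.6.3] -/
theorem words_cauchy_of_geometric {T : ℝ} {g : ℕ → ℝ → E' → W'} (hgs : ∀ N, ∀ t ∈ Icc 0 T, ContDiff ℝ ∞ (g N t))
    (hgc : ∀ N, ∀ t ∈ Icc 0 T, HasCompactSupport (g N t))
    (hdecay : ∀ K : ℕ, ∃ C : ℝ≥0∞, C ≠ ⊤ ∧ ∀ N, ∀ t ∈ Icc 0 T, sobolevEnergy K (fun y ↦ g (N + 1) t y - g N t y) ≤ C * (2⁻¹ : ℝ≥0∞) ^ N)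
    (m : ℕ) {ε : ℝ} (hε : 0 < ε) :
    ∃ N₀ : ℕ, ∀ N ≥ N₀, ∀ N' ≥ N₀, ∀ w : List (Fin (Module.finrank ℝ E')), w.length ≤ m →
      ∀ t ∈ Icc 0 T, ∀ y, ‖iterDirDeriv (w.map (stdOrthonormalBasis ℝ E')) (g N t) y -
        iterDirDeriv (w.map (stdOrthonormalBasis ℝ E')) (g N' t) y‖ ≤ ε := by
  set n : ℕ := Module.finrank ℝ E' with hn
  obtain ⟨Cs, hCstop, hCs⟩ := enorm_iterDirDeriv_sq_le (E' := E') (F' := W')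
  set K : ℕ := 2 * (n + 1) + m with hK
  obtain ⟨C, hCtop, hC⟩ := hdecay K
  -- the consecutive bound `‖∂_w (g (k+1) t - g k t) y‖ ≤ a ρ^k`
  set a : ℝ := Real.sqrt ((Cs * C).toReal) with ha
  have ha0 : 0 ≤ a := Real.sqrt_nonneg _
  set ρ : ℝ := Real.sqrt 2⁻¹ with hρ
  have hρ0 : 0 ≤ ρ := Real.sqrt_nonneg _
  have hρ1 : ρ < 1 := by rw [hρ, Real.sqrt_lt' one_pos]; norm_num
  have hρsq : ρ ^ 2 = 2⁻¹ := Real.sq_sqrt (by norm_num)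
  have hstep : ∀ k, ∀ w : List (Fin n), w.length ≤ m → ∀ t ∈ Icc 0 T, ∀ y,
      ‖iterDirDeriv (w.map (stdOrthonormalBasis ℝ E')) (g (k + 1) t) y - iterDirDeriv (w.map (stdOrthonormalBasis ℝ E')) (g k t) y‖ ≤ a * ρ ^ k := by
    intro k w hw t ht y
    have hdiff : ContDiff ℝ ∞ fun y ↦ g (k + 1) t y - g k t y := (hgs (k + 1) t ht).sub (hgs k t ht)
    have hdiffc : HasCompactSupport fun y ↦ g (k + 1) t y - g k t y := (hgc (k + 1) t ht).sub (hgc k t ht)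
    rw [← iterDirDeriv_sub_apply (hgs (k + 1) t ht) (hgs k t ht)]
    refine norm_le_of_enorm_sq_le (mul_nonneg ha0 (pow_nonneg hρ0 k)) ((hCs hdiff hdiffc w y).trans ?_)
    calc Cs * sobolevEnergy (2 * (n + 1) + w.length) (fun y ↦ g (k + 1) t y - g k t y)
        ≤ Cs * sobolevEnergy K (fun y ↦ g (k + 1) t y - g k t y) := mul_le_mul' le_rfl (sobolevEnergy_mono (by omega) _)
      _ ≤ Cs * (C * (2⁻¹ : ℝ≥0∞) ^ k) := mul_le_mul' le_rfl (hC k t ht)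
      _ = ENNReal.ofReal ((a * ρ ^ k) ^ 2) := by
          rw [mul_pow, ← pow_mul, mul_comm k 2, pow_mul, hρsq, ha, Real.sq_sqrt ENNReal.toReal_nonneg, ENNReal.ofReal_mul ENNReal.toReal_nonneg,
            ENNReal.ofReal_toReal (ENNReal.mul_ne_top hCstop hCtop), ENNReal.ofReal_pow (by norm_num), ENNReal.ofReal_inv_of_pos two_pos,
            ENNReal.ofReal_ofNat, mul_assoc]
  -- the tail
  have htail : ∀ N N', N ≤ N' → ∀ w : List (Fin n), w.length ≤ m → ∀ t ∈ Icc 0 T, ∀ y,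
      ‖iterDirDeriv (w.map (stdOrthonormalBasis ℝ E')) (g N t) y - iterDirDeriv (w.map (stdOrthonormalBasis ℝ E')) (g N' t) y‖ ≤ a * (ρ ^ N / (1 - ρ)) := by
    intro N N' hNN' w hw t ht y
    have h := dist_le_Ico_sum_dist (fun k ↦ iterDirDeriv (w.map (stdOrthonormalBasis ℝ E')) (g k t) y) hNN'
    rw [dist_eq_norm] at h
    refine h.trans ?_
    calc ∑ k ∈ Finset.Ico N N', dist (iterDirDeriv (w.map (stdOrthonormalBasis ℝ E')) (g k t) y) (iterDirDeriv (w.map (stdOrthonormalBasis ℝ E')) (g (k + 1) t) y)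
        ≤ ∑ k ∈ Finset.Ico N N', a * ρ ^ k := Finset.sum_le_sum fun k _ ↦ by
          rw [dist_comm, dist_eq_norm]; exact hstep k w hw t ht y
      _ = a * ∑ k ∈ Finset.Ico N N', ρ ^ k := by rw [Finset.mul_sum]
      _ ≤ a * (ρ ^ N / (1 - ρ)) := mul_le_mul_of_nonneg_left (geom_sum_Ico_le_of_lt_one hρ0 hρ1) ha0
  -- the threshold
  have hlim : Tendsto (fun N : ℕ ↦ a * (ρ ^ N / (1 - ρ))) atTop (𝓝 (a * (0 / (1 - ρ)))) :=
    ((tendsto_pow_atTop_nhds_zero_of_lt_one hρ0 hρ1).div_const _).const_mul a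
  rw [zero_div, mul_zero] at hlim
  obtain ⟨N₀, hN₀⟩ := (tendsto_atTop_nhds.1 hlim (Iio ε) (by simpa using hε) isOpen_Iio)
  have hN₀' : ∀ N ≥ N₀, a * (ρ ^ N / (1 - ρ)) ≤ ε := fun N hN ↦ le_of_lt (by simpa using hN₀ N hN)
  refine ⟨N₀, fun N hN N' hN' w hw t ht y ↦ ?_⟩
  rcases le_total N N' with h | h
  · exact (htail N N' h w hw t ht y).trans (hN₀' N hN)
  · rw [norm_sub_rev]
    exact (htail N' N h w hw t ht y).trans (hN₀' N' hN')

/-! ### Small tools -/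

omit [FiniteDimensional ℝ W'] in
/-- The frame sum of second-derivative energies is dominated by the energy two orders up:
`Σ_{ab} E_K(∂_a ∂_b f) ≤ E_{K+2}(f)`. [folklore] -/
theorem hessEnergy_le_sobolevEnergy (K : ℕ) (f : E' → W') : hessEnergy K f ≤ sobolevEnergy (K + 2) f := by
  rw [hessEnergy_eq]
  calc ∑ a, ∑ b, sobolevEnergy K (fun y ↦ fderiv ℝ (fun x ↦ fderiv ℝ f x (stdOrthonormalBasis ℝ E' b)) y (stdOrthonormalBasis ℝ E' a))
      = ∑ b, ∑ a, sobolevEnergy K (fun y ↦ fderiv ℝ (fun x ↦ fderiv ℝ f x (stdOrthonormalBasis ℝ E' b)) y (stdOrthonormalBasis ℝ E' a)) := Finset.sum_comm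
    _ ≤ ∑ b, sobolevEnergy (K + 1) (fun x ↦ fderiv ℝ f x (stdOrthonormalBasis ℝ E' b)) := Finset.sum_le_sum fun b _ ↦ sum_sobolevEnergy_fderiv_frame_le K _
    _ ≤ sobolevEnergy (K + 1 + 1) f := sum_sobolevEnergy_fderiv_frame_le (K + 1) f

section Charts

variable {E : Type*} [NormedAddCommGroup E] [NormedSpace ℝ E] {H : Type*} [TopologicalSpace H]
variable {I : ModelWithCorners ℝ E H} {M : Type*} [TopologicalSpace M] [ChartedSpace H M]
variable {ιb : Type*} [Fintype ιb] {ι : Type*} [Fintype ι]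

omit [MeasurableSpace E'] [BorelSpace E'] [FiniteDimensional ℝ W'] in
/-- The extended chart expressions of a chart-slab-smooth family are slab-smooth. [folklore] -/
theorem PatchSystemLoc.isSmoothSpaceTimeOn_zExpr [I.Boundaryless] [HasContDiffBump E'] (PS : PatchSystem I M E' ι) (p : ι) {T : ℝ} {v : ℝ → M → W'}
    (hv : ContDiffOn ℝ ∞ (uncurry fun s y ↦ v s ((PS.chart p).inv y)) (Icc 0 T ×ˢ (PS.chart p).target)) :
    IsSmoothSpaceTimeOn (Icc 0 T) fun s ↦ PatchSystemLoc.zExpr PS p (v s) :=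
  PatchSystemLoc.contDiffOn_slab_smul_of_tsupport_subset (PS.chart p).isOpen_target (PS.cutPlus p).contDiff (PS.tsupport_cutPlus_subset p) hv

variable [I.Boundaryless] [HasContDiffBump E'] [CompactSpace M] [T2Space M] [IsManifold I ∞ M]
variable (D : PicardData I M E' W' ιb ι)

set_option maxHeartbeats 3200000 in
/-- **The chart limits of the Picard scheme.** In the situation of `exists_iterates` (with `L`
linear on chart-smooth maps), for every chart `q` the cut-off chart expressions `ŵ_q(v_k)` and
the extended chart expressions `z_q(Θ(v_k))` of the sources converge, with all frame-word
derivatives uniformly on the slab, to limits `F_q`, `Θl_q` with smooth slices and jointly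
continuous word derivatives. [cite: TaylorPDEIII2011, Ch. 15, §7] -/
theorem PicardData.exists_word_limits {Clin : ℝ≥0∞} (hClin : Clin ≠ ⊤)
    (hAp : ∀ i : ℕ, ∃ Λ : ℝ, 1 ≤ Λ ∧ ∀ {lam : ℝ}, Λ ≤ lam → ∀ {T' : ℝ}, 0 < T' → T' ≤ 1 → ∀ {v g : ℝ → M → W'},
      (∀ q, ContDiffOn ℝ ∞ (uncurry fun s y ↦ v s ((D.PS.chart q).inv y)) (Icc 0 T' ×ˢ (D.PS.chart q).target)) →
      (∀ x, v 0 x = 0) →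
      (∀ q, ContDiffOn ℝ ∞ (uncurry fun s y ↦ g s ((D.PS.chart q).inv y)) (Icc 0 T' ×ˢ (D.PS.chart q).target)) →
      (∀ s ∈ Icc 0 T', ∀ x, derivWithin (fun s ↦ v s x) (Icc 0 T') s = linOp D.P D.u₀ (v s) x + g s x) →
      ∀ t ∈ Icc 0 T',
        (∑ p, PatchSystemLoc.maxRegQ i lam (fun s ↦ PatchSystemLoc.cutExpr D.PS p (v s)) t ≤
          Clin * ∑ p, ∫⁻ s in Ioo 0 t, ENNReal.ofReal (Real.exp (-2 * lam * s)) * sobolevEnergy i (PatchSystemLoc.cutExpr D.PS p (g s))) ∧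
        ∀ p, ENNReal.ofReal (Real.exp (-2 * lam * t)) * sobolevEnergy i (PatchSystemLoc.cutExpr D.PS p (v t)) ≤
          Clin * ENNReal.ofReal lam⁻¹ * ∑ p, ∫⁻ s in Ioo 0 t, ENNReal.ofReal (Real.exp (-2 * lam * s)) * sobolevEnergy i (PatchSystemLoc.cutExpr D.PS p (g s)))
    (hLsub : ∀ u u' : M → W', (∀ q, ContDiffOn ℝ ∞ (u ∘ (D.PS.chart q).inv) (D.PS.chart q).target) →
      (∀ q, ContDiffOn ℝ ∞ (u' ∘ (D.PS.chart q).inv) (D.PS.chart q).target) →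
      ∀ x, linOp D.P D.u₀ (fun x ↦ u x - u' x) x = linOp D.P D.u₀ u x - linOp D.P D.u₀ u' x)
    {m₀ : ℕ} (hm₀ : 2 * (Module.finrank ℝ E' + 1) + 8 ≤ m₀) {T : ℝ} (hT0 : 0 < T) (hT1 : T ≤ 1) {ε₁ : ℝ} (hε₁ : 0 < ε₁)
    {ε₀ : ℝ} (hε₁ε₀ : ε₁ ≤ ε₀) {Cs Cδ : ℝ} (hCδ0 : 0 ≤ Cδ) (hδ1 : Cδ * ε₁ ≤ 1)
    (htop : Clin * ((Fintype.card ι : ℝ≥0∞) * ENNReal.ofReal (D.ctop * (Cδ * ε₁) ^ 2)) ≤ ENNReal.ofReal 4⁻¹)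
    (hsmall : ∀ {v : M → W'}, ContMDiff I 𝓘(ℝ, W') ∞ v → ∀ {ε : ℝ}, 0 ≤ ε → ε ≤ ε₀ →
      (∀ q, sobolevEnergy (m₀ + 2 * (Module.finrank ℝ E' + 1)) (PatchSystemLoc.cutExpr D.PS q v) ≤ ENNReal.ofReal (ε ^ 2)) →
      (∀ x, (x, D.u₀ x + v x) ∈ D.𝒪) ∧
      (∀ p y, D.PS.cut p y ≠ 0 → jetQ (jetOf (v ∘ (D.PS.chart p).inv) y) ≤ D.ρ' ^ 2) ∧
      (∀ p, ∀ m ≤ m₀, ∀ y, ‖iteratedFDeriv ℝ m (PatchSystemLoc.zExpr D.PS p v) y‖ ≤ Cs * ε) ∧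
      (∀ p i i' y, |D.Gc p i i' (y, jetOf (PatchSystemLoc.zExpr D.PS p v) y)| ≤ Cδ * ε))
    {v : ℕ → ℝ → M → W'}
    (hvs : ∀ k q, ContDiffOn ℝ ∞ (uncurry fun s y ↦ v k s ((D.PS.chart q).inv y)) (Icc 0 T ×ˢ (D.PS.chart q).target))
    (hv0 : ∀ k x, v k 0 x = 0) (hv00 : ∀ s x, v 0 s x = 0)
    (heq : ∀ k, ∀ s ∈ Icc 0 T, ∀ x, derivWithin (fun s ↦ v (k + 1) s x) (Icc 0 T) s = linOp D.P D.u₀ (v (k + 1) s) x + D.theta (v k s) x)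
    (hE0 : ∀ k, ∀ s ∈ Icc 0 T, ∀ q, sobolevEnergy (m₀ + 2 * (Module.finrank ℝ E' + 1)) (PatchSystemLoc.cutExpr D.PS q (v k s)) ≤ ENNReal.ofReal (ε₁ ^ 2))
    (q : ι) :
    ∃ F Θl : ℝ → E' → W',
      ((∀ t ∈ Icc 0 T, ContDiff ℝ ∞ (F t)) ∧
        (∀ β : List E', TendstoUniformlyOn (fun N (p : ℝ × E') ↦ iterDirDeriv β (PatchSystemLoc.cutExpr D.PS q (v N p.1)) p.2)
          (fun p ↦ iterDirDeriv β (F p.1) p.2) atTop (Icc 0 T ×ˢ univ)) ∧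
        (∀ β : List E', ContinuousOn (fun p : ℝ × E' ↦ iterDirDeriv β (F p.1) p.2) (Icc 0 T ×ˢ univ)) ∧
        (∀ t ∈ Icc 0 T, ∀ y, Tendsto (fun N ↦ PatchSystemLoc.cutExpr D.PS q (v N t) y) atTop (𝓝 (F t y))) ∧
        (∀ (m : ℕ) (ε : ℝ), 0 < ε → ∃ N₀ : ℕ, ∀ N ≥ N₀, ∀ w : List (Fin (Module.finrank ℝ E')), w.length ≤ m →
          ∀ t ∈ Icc 0 T, ∀ y, ‖iterDirDeriv (w.map (stdOrthonormalBasis ℝ E')) (PatchSystemLoc.cutExpr D.PS q (v N t)) y -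
            iterDirDeriv (w.map (stdOrthonormalBasis ℝ E')) (F t) y‖ ≤ ε)) ∧
      ((∀ t ∈ Icc 0 T, ContDiff ℝ ∞ (Θl t)) ∧
        (∀ β : List E', TendstoUniformlyOn (fun N (p : ℝ × E') ↦ iterDirDeriv β (PatchSystemLoc.zExpr D.PS q (D.theta (v N p.1))) p.2)
          (fun p ↦ iterDirDeriv β (Θl p.1) p.2) atTop (Icc 0 T ×ˢ univ)) ∧
        (∀ β : List E', ContinuousOn (fun p : ℝ × E' ↦ iterDirDeriv β (Θl p.1) p.2) (Icc 0 T ×ˢ univ)) ∧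
        (∀ t ∈ Icc 0 T, ∀ y, Tendsto (fun N ↦ PatchSystemLoc.zExpr D.PS q (D.theta (v N t)) y) atTop (𝓝 (Θl t y))) ∧
        (∀ (m : ℕ) (ε : ℝ), 0 < ε → ∃ N₀ : ℕ, ∀ N ≥ N₀, ∀ w : List (Fin (Module.finrank ℝ E')), w.length ≤ m →
          ∀ t ∈ Icc 0 T, ∀ y, ‖iterDirDeriv (w.map (stdOrthonormalBasis ℝ E')) (PatchSystemLoc.zExpr D.PS q (D.theta (v N t))) y -
            iterDirDeriv (w.map (stdOrthonormalBasis ℝ E')) (Θl t) y‖ ≤ ε)) := by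
  classical
  set n' : ℕ := 2 * (Module.finrank ℝ E' + 1) with hn'
  have hslices : ∀ k, ∀ s ∈ Icc 0 T, ContMDiff I 𝓘(ℝ, W') ∞ (v k s) ∧ (∀ x, (x, D.u₀ x + v k s x) ∈ D.𝒪) ∧
      (∀ p y, D.PS.cut p y ≠ 0 → jetQ (jetOf (v k s ∘ (D.PS.chart p).inv) y) ≤ D.ρ' ^ 2) ∧
      (∀ p i i' y, |D.Gc p i i' (y, jetOf (PatchSystemLoc.zExpr D.PS p (v k s)) y)| ≤ Cδ * ε₁) := by
    intro k s hs
    have hvsm : ContMDiff I 𝓘(ℝ, W') ∞ (v k s) := PatchSystemLoc.contMDiff_of_chartSmooth D.PS (PatchSystemLoc.chartSmooth_slice D.PS (hvs k) hs)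
    obtain ⟨hg, hj, -, hδ⟩ := hsmall hvsm hε₁.le hε₁ε₀ (hE0 k s hs)
    exact ⟨hvsm, hg, hj, hδ⟩
  have hδ₁0 : 0 ≤ Cδ * ε₁ := mul_nonneg hCδ0 hε₁.le
  -- the sources are chart-slab-smooth
  have hΘs : ∀ k, ∀ p, ContDiffOn ℝ ∞ (uncurry fun s y ↦ D.theta (v k s) ((D.PS.chart p).inv y)) (Icc 0 T ×ˢ (D.PS.chart p).target) := fun k ↦
    D.theta_chartSlabSmooth' hT0 (hvs k) (fun s hs ↦ (hslices k s hs).1) (fun s hs ↦ (hslices k s hs).2.1)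
  /- ## limits of the cut-off chart expressions -/
  have hfs : ∀ N, IsSmoothSpaceTimeOn (Icc 0 T) fun t ↦ PatchSystemLoc.cutExpr D.PS q (v N t) := fun N ↦ PatchSystemLoc.isSmoothSpaceTimeOn_cutExpr D.PS q (hvs N q)
  have hfC := words_cauchy_of_geometric (g := fun N t ↦ PatchSystemLoc.cutExpr D.PS q (v N t)) (fun N t ht ↦ (hfs N).contDiff_slice ht)
    (fun N t _ ↦ PatchSystemLoc.hasCompactSupport_cutExpr D.PS _) (fun K ↦ by
      obtain ⟨Cd, hCdtop, hCd⟩ := D.iterates_contract hClin hAp hLsub hm₀ hT0 hT1 hε₁ hε₁ε₀ hCδ0 hδ1 htop hsmall hvs hv0 hv00 heq hE0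
        (max K (m₀ + n')) (le_max_right _ _)
      refine ⟨Cd, hCdtop, fun N t ht ↦ ?_⟩
      rw [← PatchSystemLoc.cutExpr_sub']
      exact (sobolevEnergy_mono (le_max_left _ _) _).trans (hCd N t ht q))
  obtain ⟨F, hFs, hFu, hFc, hFlim⟩ := exists_slab_limit_of_words_cauchy hT0 hfs hfC
  /- ## limits of the sources -/
  have hgs : ∀ N, IsSmoothSpaceTimeOn (Icc 0 T) fun t ↦ PatchSystemLoc.zExpr D.PS q (D.theta (v N t)) := fun N ↦
    PatchSystemLoc.isSmoothSpaceTimeOn_zExpr D.PS q (hΘs N q)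
  have hgC := words_cauchy_of_geometric (g := fun N t ↦ PatchSystemLoc.zExpr D.PS q (D.theta (v N t))) (fun N t ht ↦ (hgs N).contDiff_slice ht)
    (fun N t _ ↦ PatchSystemLoc.hasCompactSupport_zExpr D.PS _ _) (fun K ↦ by
      -- sup bounds of all derivatives up to `K + 2`
      obtain ⟨RE, hRE0, hRE⟩ := D.iterates_bounded hClin hAp hm₀ hT0 hT1 hε₁ hε₁ε₀ hCδ0 hδ1 htop hsmall hvs hv0 hv00 heq hE0 (max (K + 2 + n') (m₀ + n')) (le_max_right _ _)
      obtain ⟨Cs', hCs'0, hCs'⟩ := PatchSystemLoc.norm_iteratedFDeriv_zExpr_le D.PS (F' := W') (K + 2)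
      set Rall : ℝ := Cs' * Real.sqrt RE with hRall
      have hsup : ∀ k, ∀ s ∈ Icc 0 T, ∀ p, ∀ m ≤ K + 2, ∀ y, ‖iteratedFDeriv ℝ m (PatchSystemLoc.zExpr D.PS p (v k s)) y‖ ≤ Rall := by
        intro k s hs p m hm y
        refine hCs' p (PatchSystemLoc.chartSmooth_slice D.PS (hvs k) hs) (Real.sqrt_nonneg RE) (fun q' ↦ ?_) m hm y
        rw [Real.sq_sqrt hRE0]
        exact (sobolevEnergy_mono (le_max_left _ _) _).trans (hRE k s hs q')
      obtain ⟨Bd, hBdtop, hBd⟩ := D.sum_energy_theta_sub_le K Rall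
      obtain ⟨Cl, hCltop, hCl⟩ := PatchSystemLoc.sobolevEnergy_zExpr_le D.PS (F' := W') K
      obtain ⟨Cd, hCdtop, hCd⟩ := D.iterates_contract hClin hAp hLsub hm₀ hT0 hT1 hε₁ hε₁ε₀ hCδ0 hδ1 htop hsmall hvs hv0 hv00 heq hE0
        (max (K + 2) (m₀ + n')) (le_max_right _ _)
      refine ⟨Cl * ((ENNReal.ofReal (D.ctop * (Cδ * ε₁) ^ 2) + Bd) * ((Fintype.card ι : ℝ≥0∞) * Cd)),
        ENNReal.mul_ne_top hCltop (ENNReal.mul_ne_top (ENNReal.add_ne_top.2 ⟨ENNReal.ofReal_ne_top, hBdtop⟩)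
          (ENNReal.mul_ne_top (ENNReal.natCast_ne_top _) hCdtop)), fun N t ht ↦ ?_⟩
      have hθsub : ∀ p, ContDiffOn ℝ ∞ ((fun x ↦ D.theta (v (N + 1) t) x - D.theta (v N t) x) ∘ (D.PS.chart p).inv) (D.PS.chart p).target := fun p ↦
        (PatchSystemLoc.chartSmooth_slice D.PS (hΘs (N + 1)) ht p).sub (PatchSystemLoc.chartSmooth_slice D.PS (hΘs N) ht p)
      rw [← PatchSystemLoc.zExpr_sub, mul_assoc]
      refine (hCl q hθsub).trans (mul_le_mul' le_rfl ?_)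
      have hX : ∀ p, sobolevEnergy (K + 2) (PatchSystemLoc.cutExpr D.PS p (fun x ↦ v (N + 1) t x - v N t x)) ≤ Cd * (2⁻¹ : ℝ≥0∞) ^ N := fun p ↦
        (sobolevEnergy_mono (le_max_left _ _) _).trans (hCd N t ht p)
      have h := hBd (hslices (N + 1) t ht).1 (hslices N t ht).1 (hslices (N + 1) t ht).2.1 (hslices N t ht).2.1 (hslices (N + 1) t ht).2.2.1 (hslices N t ht).2.2.1
        (hsup (N + 1) t ht) (hsup N t ht) hδ₁0 hδ1 (hslices (N + 1) t ht).2.2.2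
      refine h.trans ?_
      have h1 : ∑ p, hessEnergy K (PatchSystemLoc.cutExpr D.PS p (fun x ↦ v (N + 1) t x - v N t x)) ≤ (Fintype.card ι : ℝ≥0∞) * Cd * (2⁻¹ : ℝ≥0∞) ^ N := by
        calc _ ≤ ∑ _p : ι, Cd * (2⁻¹ : ℝ≥0∞) ^ N := Finset.sum_le_sum fun p _ ↦ (hessEnergy_le_sobolevEnergy K _).trans (hX p)
          _ = _ := by rw [Finset.sum_const, Finset.card_univ, nsmul_eq_mul]; ring
      have h2 : ∑ p, sobolevEnergy (K + 1) (PatchSystemLoc.cutExpr D.PS p (fun x ↦ v (N + 1) t x - v N t x)) ≤ (Fintype.card ι : ℝ≥0∞) * Cd * (2⁻¹ : ℝ≥0∞) ^ N := by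
        calc _ ≤ ∑ _p : ι, Cd * (2⁻¹ : ℝ≥0∞) ^ N := Finset.sum_le_sum fun p _ ↦ (sobolevEnergy_mono (Nat.le_succ _) _).trans (hX p)
          _ = _ := by rw [Finset.sum_const, Finset.card_univ, nsmul_eq_mul]; ring
      calc ENNReal.ofReal (D.ctop * (Cδ * ε₁) ^ 2) * ∑ p, hessEnergy K (PatchSystemLoc.cutExpr D.PS p (fun x ↦ v (N + 1) t x - v N t x)) +
            Bd * ∑ p, sobolevEnergy (K + 1) (PatchSystemLoc.cutExpr D.PS p (fun x ↦ v (N + 1) t x - v N t x))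
          ≤ ENNReal.ofReal (D.ctop * (Cδ * ε₁) ^ 2) * ((Fintype.card ι : ℝ≥0∞) * Cd * (2⁻¹ : ℝ≥0∞) ^ N) + Bd * ((Fintype.card ι : ℝ≥0∞) * Cd * (2⁻¹ : ℝ≥0∞) ^ N) :=
            add_le_add (mul_le_mul' le_rfl h1) (mul_le_mul' le_rfl h2)
        _ = _ := by ring)
  obtain ⟨Θl, hΘls, hΘlu, hΘlc, hΘllim⟩ := exists_slab_limit_of_words_cauchy hT0 hgs hgC
  /- ## smallness in the `∃ N₀` form -/
  have hsm : ∀ {g : ℕ → ℝ → E' → W'} {G : ℝ → E' → W'},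
      (∀ (m : ℕ) (ε : ℝ), 0 < ε → ∃ N₀ : ℕ, ∀ N ≥ N₀, ∀ N' ≥ N₀, ∀ w : List (Fin (Module.finrank ℝ E')), w.length ≤ m →
        ∀ t ∈ Icc 0 T, ∀ y, ‖iterDirDeriv (w.map (stdOrthonormalBasis ℝ E')) (g N t) y - iterDirDeriv (w.map (stdOrthonormalBasis ℝ E')) (g N' t) y‖ ≤ ε) →
      (∀ β : List E', TendstoUniformlyOn (fun N (p : ℝ × E') ↦ iterDirDeriv β (g N p.1) p.2) (fun p ↦ iterDirDeriv β (G p.1) p.2) atTop (Icc 0 T ×ˢ univ)) →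
      ∀ (m : ℕ) (ε : ℝ), 0 < ε → ∃ N₀ : ℕ, ∀ N ≥ N₀, ∀ w : List (Fin (Module.finrank ℝ E')), w.length ≤ m →
        ∀ t ∈ Icc 0 T, ∀ y, ‖iterDirDeriv (w.map (stdOrthonormalBasis ℝ E')) (g N t) y - iterDirDeriv (w.map (stdOrthonormalBasis ℝ E')) (G t) y‖ ≤ ε := by
    intro g G hC hU m ε hε
    obtain ⟨N₀, hN₀⟩ := hC m ε hε
    refine ⟨N₀, fun N hN w hw t ht y ↦ ?_⟩
    have hlim : Tendsto (fun N' ↦ iterDirDeriv (w.map (stdOrthonormalBasis ℝ E')) (g N t) y - iterDirDeriv (w.map (stdOrthonormalBasis ℝ E')) (g N' t) y) atTop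
        (𝓝 (iterDirDeriv (w.map (stdOrthonormalBasis ℝ E')) (g N t) y - iterDirDeriv (w.map (stdOrthonormalBasis ℝ E')) (G t) y)) :=
      tendsto_const_nhds.sub ((hU _).tendsto_at (mk_mem_prod ht (mem_univ y)))
    refine le_of_tendsto hlim.norm ?_
    filter_upwards [Filter.eventually_ge_atTop N₀] with N' hN'
    exact hN₀ N hN N' hN' w hw t ht y
  exact ⟨F, Θl, ⟨hFs, hFu, hFc, hFlim, hsm hfC hFu⟩, ⟨hΘls, hΘlu, hΘlc, hΘllim, hsm hgC hΘlu⟩⟩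

end Charts

end Literature.Analysis.PDE
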